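import Summits.BirchSwinnertonDyer.BirchSwinnertonDyer.Theorems.ResidualThetaTransportAtTwoSignedMuPropagationAtTwoRSel2Transfer
import HarnessLib

/-!
# Stub `stub_primToSel2` (S2) of line `norm-one-torus` of the crux `SignedMuSeedAtTwoPlus`
# (stmt-BirchSwinnertonDyer-21438 = `stub_residualSeedAtTwo` of Kμ⁺ stmt-BirchSwinnertonDyer-20689 BY NAME,
# route `ResidualThetaTransportAtTwo`) — PROVED (width seat bsd-wall-rtt-p4-w3 g6; `--supports stmt-BirchSwinnertonDyer-21438`)

HONEST FRAMING. ONE THEOREM (no `def`, no named fact, no `sorry`); the file proves the registered stub S2 of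
`Cruxes/SignedMuSeedAtTwoPlus/Lines/norm_one_torus.lean` (sha b593f1fbe717) with the line's local definition
`primResidualPlus` UNFOLDED verbatim (so that `exact primToSel2` closes the stub inside the skeleton); the crux stays open
(the certificate stub S3 `stub_primCertificate`); BSD is not proved by any of this. No import of any route file beyond what
the consumed helper already imports.

WHAT (Greenberg–Vatsal §2 / B. D. Kim Prop. 2.10 READ AT `2`, for ONE curve `A := W`), assembled BY NAME from this seat-line's
earlier one-curve dévissage (`Theorems/ResidualThetaTransportAtTwoSignedMuPropagationAtTwoRSel2Transfer.lean`, ns `Sel2TransferAtTwo`):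
`primToSel2` — S2 VERBATIM: primitive residual plus-set `R♯_∅(W)` finite ⇒ `{s ∈ Sel⁺(W/ℚ_∞) | 2s = 0}` finite, through
(i) `S₀ :=` the bad places of `W` (finite, `finite_badPlaces_holds`; odd, `hasGoodReductionAt_of_hasGoodReductionAtPrime` from
`GoodSS W 2`), (ii) `residualSharp_finite_of_residualSharp_empty_finite` (`R♯_∅(W)` finite ⇒ `R♯_{S₀}(W)` finite: the detecting
map to finitely many `H¹(I_w(ℚ_∞), W[2^∞][2])`), (iii) `sel2Finite_of_residualSharp_finite` (`Δ_W < 0`, `S₀ ⊇` bad places: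
`Sel⁺ ≤ Sel♯_{S₀}` and `Sel♯_{S₀}[2] = k(R♯_{S₀})`).

References: [GreenbergVatsal2000] p. 3, §2 pp. 17, 20–21, 28, Prop. (2.8); [BDKim2009] Prop. 2.10; [Kobayashi2003] Def. 1.1.
-/

set_option autoImplicit false
-- D-0017: single-problem summit, so `Summit.BirchSwinnertonDyer.BirchSwinnertonDyer.…` repeats a namespace BY DESIGN.
set_option linter.dupNamespace false

noncomputable section

open scoped Classical AddSubgroup

open WeierstrassCurve NumberField IsDedekindDomain Field Literature Literature.NumberTheory.EllipticCurves
  Literature.NumberTheory.GaloisRepresentations Literature.NumberTheory.EllipticCurves.Kobayashi2003 ZpExtension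
  Literature.NumberTheory.EllipticCurves.GreenbergVatsal2000 Literature.NumberTheory.EllipticCurves.GreenbergSelmer
  Literature.NumberTheory.EllipticCurves.Rank1Residual
  Summit.BirchSwinnertonDyer.BirchSwinnertonDyer.Theorems.SignedTransportAtTwo
  Summit.BirchSwinnertonDyer.BirchSwinnertonDyer.Theorems.Sel2TransferAtTwo

namespace Summit.BirchSwinnertonDyer.BirchSwinnertonDyer.Theorems.SignedMuAtTwo.NormOneTorus

/-! ## The registered stub S2 `stub_primToSel2` of line `norm-one-torus` -/

/-- **S2 · primToSel2** (= `stub_primToSel2` of `Cruxes/SignedMuSeedAtTwoPlus/Lines/norm_one_torus.lean`, with the line's local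
definition `primResidualPlus` unfolded verbatim; primitive ⇒ member, `A := W`). If the primitive residual signed-plus set of
`W[2^∞][2]` over `ℚ_∞` (classes unramified at every odd place, residually trivial at `∞`, signed-plus at `2`) is finite, then
`{s ∈ Sel⁺(W/ℚ_∞) | 2s = 0}` is finite: with `S₀ :=` the (finite, odd) set of bad places of `W`, (i) imprimitive finiteness at
`S₀` (`Sel2TransferAtTwo.residualSharp_finite_of_residualSharp_empty_finite`: the detecting map into finitely many
`H¹(I_w(ℚ_∞), W[2^∞][2])`), (ii) `Sel⁺(W/ℚ_∞) ≤ Sel♯_{S₀}` and `Sel♯_{S₀}[2] = k(R♯_{S₀}(W))` for `Δ_W < 0`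
(`Sel2TransferAtTwo.sel2Finite_of_residualSharp_finite`). (The hypotheses `¬ W.HasCM` and `a₂(W) = 0` of the registered
signature are idle.) [cite: GreenbergVatsal2000, p. 3 and Prop. (2.8)] [cite: BDKim2009, Prop. 2.10] [cite: Kobayashi2003, Def. 1.1] -/
theorem primToSel2 :
    ∀ (W : WeierstrassCurve ℚ) [W.IsElliptic] [W.IsGloballyMinimal], ¬ W.HasCM → GoodSS W 2 → W.frobeniusTrace 2 = 0 →
      W.Δ < 0 → ∀ (κ : ZpExtension ℚ 2), κ.IsCyclotomic →
      {c : subgroupH1 κ.kerSubgroup ↥((↥(W.geomPrimaryTorsion 2))[(2 : ℤ)]) |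
        c ∈ unramifiedOutside κ.kerSubgroup ↥((↥(W.geomPrimaryTorsion 2))[(2 : ℤ)]) 2
              (∅ : Set (HeightOneSpectrum (𝓞 ℚ))) ∧
          (∀ (w : InfinitePlace ℚ) (σ : Field.absoluteGaloisGroup ℚ),
            Literature.NumberTheory.EllipticCurves.conjH1 κ.kerSubgroup ↥((↥(W.geomPrimaryTorsion 2))[(2 : ℤ)]) σ c ∈
              GreenbergSelmer.infKer κ.kerSubgroup ↥((↥(W.geomPrimaryTorsion 2))[(2 : ℤ)]) w) ∧
          (∀ (v : HeightOneSpectrum (𝓞 ℚ)), ((2 : ℕ) : 𝓞 ℚ) ∈ v.asIdeal → ∀ σ : Field.absoluteGaloisGroup ℚ,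
            W.conjH1 2 κ.kerSubgroup σ
                (pushH1 κ.kerSubgroup ((↥(W.geomPrimaryTorsion 2))[(2 : ℤ)]).subtype (subtype_torsionBy_smul W 2) c) ∈
              localKummerOverOfEmb W 2 κ.kerSubgroup (closureEmb (K := ℚ) (v.adicCompletion ℚ))
                (⨆ n : ℕ, signedLocalPoints κ (v.adicCompletion ℚ) W 1 n))}.Finite →
      {s : signedSelmerInfty W κ 1 | 2 • s = 0}.Finite := by
  intro W _ _ _hCM hss _ha2 hΔ κ hκ hprim
  -- `S₀` := the bad places of `W`: finite and odd
  have hbad : (W.badPlaces (𝓞 ℚ)).Finite := WeierstrassCurve.finite_badPlaces_holds (𝓞 ℚ) W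
  have hSW : ∀ v : HeightOneSpectrum (𝓞 ℚ), ¬ W.HasGoodReductionAt v → v ∈ hbad.toFinset := fun v hv ↦ by
    rw [Set.Finite.mem_toFinset]; exact hv
  have hS2 : ∀ v ∈ hbad.toFinset, ((2 : ℕ) : 𝓞 ℚ) ∉ v.asIdeal := by
    intro v hv h2
    rw [Set.Finite.mem_toFinset] at hv
    exact hv (W.hasGoodReductionAt_of_hasGoodReductionAtPrime v h2 hss.1)
  -- `R♯_∅(W)` finite ⟹ `R♯_{S₀}(W)` finite ⟹ `Sel⁺(W/ℚ_∞)[2]` finite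
  exact sel2Finite_of_residualSharp_finite W hΔ κ hbad.toFinset hSW
    (residualSharp_finite_of_residualSharp_empty_finite W κ hκ hbad.toFinset hS2 hprim)

end Summit.BirchSwinnertonDyer.BirchSwinnertonDyer.Theorems.SignedMuAtTwo.NormOneTorus

end
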